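import Mathlib
import HarnessLib
import Literature.Analysis.FunctionSpaces.SobolevDomain
import Literature.Analysis.FunctionSpaces.DuBoisReymondAE
import Literature.Analysis.FluidPDE.RadialCalculus

/-!
# Stub `stub_radialFluxShellInvariance` — crux `PointSink.ConeDesingularisation` (stmt-AnomalousDissipation-19034), line `Sketch`

**What.** Let `W : ℝ³ → ℝ³` be locally integrable off the origin and weakly divergence-free
there: `∫ ⟪W, ∇θ⟫ = 0` for every smooth compactly supported `θ` with `tsupport θ ⊆ ℝ³ ∖ {0}`.
Then the radial flux through a spherical shell, `F(a,b) = ∫_{a<|x|<b} ⟪W(x), x⟫/|x|²`, is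
dilation invariant: `F(a,b) = F(ca,cb)` for all `0 < a < b`, `0 < c` (it depends on `b/a` only,
so `F(a,b)/log(b/a)` is *the* flux of `W` through spheres about the origin).

**Why.** Part 1 of the flux-rigidity lemma D1 of line `Sketch` (renormalised discretely
self-similar Euler cones are fluxless): applied to `W = β(H)V` it makes the renormalised radial
energy flux of a DSS cone scale invariant, after which two dominated limits kill it.

**How (no polar coordinates, no traces).** For a smooth plateau `K` supported in `(a², b²)`
(variable `u = |x|²`) put `g(v) = K(v)/v`, `Φ(u) = ∫₀ᵘ g` and test the hypothesis with the
dilation difference `θ(x) = Φ(|x|²) - Φ(|x|²/c²)`: it is smooth, vanishes near the origin (both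
terms vanish for `|x|² ≤ min(1,c²) a²`) and far out (both terms equal the constant `Φ(b²)`), and
`⟪W, ∇θ⟫ = 2 (K(|x|²) - K(|x|²/c²)) ⟪W,x⟫/|x|²` — the factor `c⁻²` of the chain rule cancels
against `g(u/c²) = c² K(u/c²)/u` (`radialFlux_plateau_identity`). Choosing plateaus
`K_n → 1_{(a²,b²)}` pointwise (`radialFlux_exists_plateau`: Mathlib bump functions on `ℝ` with
fixed outer radius and inner radii increasing to it) and dominating by `|⟪W,x⟫|/|x|²` on a fixed
compact shell avoiding the origin, dominated convergence gives `F(a,b) - F(ca,cb) = 0`.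

Sources: folklore (the smooth homogeneous case: R. Shvydkoy, *Homogeneous solutions to the 3D
Euler system*, Trans. AMS 370 (2018) = arXiv:1510.03378, §6). Tools: Mathlib (`ContDiffBump`,
`MeasureTheory.tendsto_integral_of_dominated_convergence`), tree
(`Literature.Analysis.FunctionSpaces.contDiff_primitive`,
`Literature.Analysis.FluidPDE.fderiv_comp_norm_sq_apply`).
-/

noncomputable section

-- `Summit.<Summit>.<Problem>`: single-conjunct summit, the duplicate namespace is mandated (CONVENTIONS §2).
set_option linter.dupNamespace false

namespace Summit.AnomalousDissipation.AnomalousDissipation.Theorems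

open MeasureTheory Filter Topology Set
open scoped ContDiff
open Literature.Analysis.FunctionSpaces

/-- Points / vector values of `ℝ³`. -/
local notation "E³" => EuclideanSpace ℝ (Fin 3)

/-! ### One-variable tools: plateaus and their weighted primitives -/

/-- A smooth `K : ℝ → ℝ` vanishing below a positive level `δ` gives a smooth `v ↦ K(v) v⁻¹`
(near `0` the product vanishes identically, off `0` inversion is smooth). -/
theorem radialFlux_contDiff_mul_inv {K : ℝ → ℝ} {δ : ℝ} (hK : ContDiff ℝ ∞ K) (hδ : 0 < δ)
    (h0 : ∀ v, v < δ → K v = 0) : ContDiff ℝ ∞ fun v => K v * v⁻¹ := by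
  refine contDiff_iff_contDiffAt.2 fun v => ?_
  rcases eq_or_ne v 0 with rfl | hv
  · refine (contDiffAt_const (c := (0 : ℝ))).congr_of_eventuallyEq ?_
    filter_upwards [Iio_mem_nhds hδ] with w hw
    rw [h0 w hw, zero_mul]
  · exact hK.contDiffAt.mul (contDiffAt_inv ℝ hv)

/-- The primitive `u ↦ ∫₀ᵘ g` of a function vanishing on `(-∞, δ]`, `0 < δ`, vanishes there. -/
theorem radialFlux_primitive_eq_zero {g : ℝ → ℝ} {δ u : ℝ} (hδ : 0 < δ)
    (h0 : ∀ v, v ≤ δ → g v = 0) (hu : u ≤ δ) : ∫ v in (0 : ℝ)..u, g v = 0 := by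
  refine (intervalIntegral.integral_congr (g := fun _ => (0 : ℝ)) fun v hv => ?_).trans (by simp)
  exact h0 v (hv.2.trans (sup_le hδ.le hu))

/-- The primitive `u ↦ ∫₀ᵘ g` of a continuous function vanishing on `[M, ∞)` is constant
there. -/
theorem radialFlux_primitive_eq_const {g : ℝ → ℝ} {M u : ℝ} (hg : Continuous g)
    (hM : ∀ v, M ≤ v → g v = 0) (hu : M ≤ u) :
    ∫ v in (0 : ℝ)..u, g v = ∫ v in (0 : ℝ)..M, g v := by
  have h2 : ∫ v in M..u, g v = 0 := by
    refine (intervalIntegral.integral_congr (g := fun _ => (0 : ℝ)) fun v hv => ?_).trans (by simp)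
    rw [uIcc_of_le hu] at hv
    exact hM v hv.1
  rw [← intervalIntegral.integral_add_adjacent_intervals (hg.intervalIntegrable 0 M)
    (hg.intervalIntegrable M u), h2, add_zero]

/-- **Plateaus exhausting an open interval.** For `0 < a < b` there are smooth
`K_n : ℝ → [0, 1]` supported in `(a², b²)` with `K_n(u) = 1` eventually for every
`u ∈ (a², b²)`: bump functions centred at `(a² + b²)/2` with outer radius `(b² - a²)/2` and
inner radii increasing to it. -/
theorem radialFlux_exists_plateau {a b : ℝ} (ha : 0 < a) (hab : a < b) :
    ∃ K : ℕ → ℝ → ℝ, (∀ n, ContDiff ℝ ∞ (K n)) ∧ (∀ n u, 0 ≤ K n u ∧ K n u ≤ 1) ∧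
      (∀ n u, K n u ≠ 0 → a ^ 2 < u ∧ u < b ^ 2) ∧
      ∀ u, a ^ 2 < u → u < b ^ 2 → ∀ᶠ n in atTop, K n u = 1 := by
  have hab2 : a ^ 2 < b ^ 2 := by gcongr
  set m : ℝ := (a ^ 2 + b ^ 2) / 2 with hm
  set r : ℝ := (b ^ 2 - a ^ 2) / 2 with hr
  have hr0 : 0 < r := by rw [hr]; linarith
  have hε : ∀ n : ℕ, 0 < r / 2 * (1 / ((n : ℝ) + 1)) ∧ r / 2 * (1 / ((n : ℝ) + 1)) ≤ r / 2 :=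
    fun n => ⟨by positivity, mul_le_of_le_one_right (by positivity)
      ((div_le_one (by positivity)).2 (le_add_of_nonneg_left n.cast_nonneg))⟩
  let φ : ℕ → ContDiffBump m := fun n =>
    ⟨r - r / 2 * (1 / ((n : ℝ) + 1)), r, by linarith [(hε n).2], sub_lt_self r (hε n).1⟩
  refine ⟨fun n u => φ n u, fun n => (φ n).contDiff, fun n u => ⟨(φ n).nonneg, (φ n).le_one⟩,
    fun n u hu => ?_, fun u hu1 hu2 => ?_⟩
  · have hmem : u ∈ Function.support (φ n : ℝ → ℝ) := hu
    rw [(φ n).support_eq, Metric.mem_ball, Real.dist_eq, abs_sub_lt_iff] at hmem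
    change u - m < r ∧ m - u < r at hmem
    constructor <;> linarith [hmem.1, hmem.2]
  · have ht : Tendsto (fun n : ℕ => r / 2 * (1 / ((n : ℝ) + 1))) atTop (𝓝 0) := by
      simpa using (tendsto_one_div_add_atTop_nhds_zero_nat (𝕜 := ℝ)).const_mul (r / 2)
    have hgap : 0 < r - |u - m| := by
      rw [sub_pos, abs_sub_lt_iff]
      constructor <;> linarith
    filter_upwards [ht.eventually_lt_const hgap] with n hn
    apply (φ n).one_of_mem_closedBall
    rw [Metric.mem_closedBall, Real.dist_eq]
    change |u - m| ≤ r - r / 2 * (1 / ((n : ℝ) + 1))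
    linarith

/-! ### The dilation-difference test function -/

/-- `a² < r²/c² < b²` iff `ca < r < cb` (`0 ≤ a, b, r`, `0 < c`). -/
theorem radialFlux_sq_div_lt_iff {a b c r : ℝ} (ha : 0 ≤ a) (hb : 0 ≤ b) (hc : 0 < c)
    (hr : 0 ≤ r) : (a ^ 2 < r ^ 2 / c ^ 2 ∧ r ^ 2 / c ^ 2 < b ^ 2) ↔ (c * a < r ∧ r < c * b) := by
  rw [← div_pow, sq_lt_sq₀ ha (div_nonneg hr hc.le), sq_lt_sq₀ (div_nonneg hr hc.le) hb,
    lt_div_iff₀' hc, div_lt_iff₀' hc]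

/-- For a smooth profile `Φ` vanishing on `(-∞, a²]` and constant on `[b², ∞)` (`0 < a < b`,
`0 < c`), the dilation difference `x ↦ Φ(|x|²) - Φ(|x|²/c²)` is a test function on
`ℝ³ ∖ {0}`: smooth, zero on the ball of radius `min(a, ca)` and off the ball of radius
`max(b, cb)`. -/
theorem radialFlux_isTestFunctionOn {Φ : ℝ → ℝ} {a b c : ℝ} (hΦ : ContDiff ℝ ∞ Φ) (ha : 0 < a)
    (hab : a < b) (hc : 0 < c) (h0 : ∀ u, u ≤ a ^ 2 → Φ u = 0)
    (h1 : ∀ u, b ^ 2 ≤ u → Φ u = Φ (b ^ 2)) :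
    IsTestFunctionOn ⟨{x : E³ | x ≠ 0}, isOpen_ne⟩
      (fun x : E³ => Φ (‖x‖ ^ 2) - Φ (‖x‖ ^ 2 / c ^ 2)) := by
  have hb : 0 < b := ha.trans hab
  refine ⟨(hΦ.comp (contDiff_norm_sq ℝ)).sub (hΦ.comp ((contDiff_norm_sq ℝ).div_const _)), ?_, ?_⟩
  · refine HasCompactSupport.intro (isCompact_closedBall (0 : E³) (max b (c * b))) fun x hx => ?_
    rw [Metric.mem_closedBall, dist_zero_right, not_le, max_lt_iff] at hx
    have hx1 : b ^ 2 ≤ ‖x‖ ^ 2 := pow_le_pow_left₀ hb.le hx.1.le 2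
    have hx2 : b ^ 2 ≤ ‖x‖ ^ 2 / c ^ 2 := by
      rw [le_div_iff₀ (by positivity), ← mul_pow]
      exact pow_le_pow_left₀ (by positivity) (by linarith [hx.2]) 2
    show Φ (‖x‖ ^ 2) - Φ (‖x‖ ^ 2 / c ^ 2) = 0
    rw [h1 _ hx1, h1 _ hx2, sub_self]
  · intro x hx
    show x ≠ 0
    rintro rfl
    refine (notMem_tsupport_iff_eventuallyEq.2 ?_) hx
    filter_upwards [Metric.ball_mem_nhds (0 : E³) (show 0 < min a (c * a) by positivity)]
      with y hy
    rw [Metric.mem_ball, dist_zero_right, lt_min_iff] at hy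
    have hy1 : ‖y‖ ^ 2 ≤ a ^ 2 := pow_le_pow_left₀ (norm_nonneg _) hy.1.le 2
    have hy2 : ‖y‖ ^ 2 / c ^ 2 ≤ a ^ 2 := by
      rw [div_le_iff₀ (by positivity), ← mul_pow]
      exact pow_le_pow_left₀ (norm_nonneg _) (by linarith [hy.2]) 2
    show Φ (‖y‖ ^ 2) - Φ (‖y‖ ^ 2 / c ^ 2) = 0
    rw [h0 _ hy1, h0 _ hy2, sub_self]

/-- `⟪w, ∇θ(x)⟫ = Dθ(x) w` (Riesz representation of the Fréchet derivative). -/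
theorem radialFlux_inner_gradient (θ : E³ → ℝ) (x w : E³) :
    inner ℝ w (gradient θ x) = fderiv ℝ θ x w := by
  rw [real_inner_comm, gradient, InnerProductSpace.toDual_symm_apply]

/-- **The plateau identity.** If `W` is weakly divergence-free off the origin, then for every
smooth plateau `K` supported in `(a², b²)` and every `c > 0`,
`∫ (K(|x|²) - K(|x|²/c²)) ⟪W,x⟫/|x|² dx = 0`: test the hypothesis with
`θ(x) = Φ(|x|²) - Φ(|x|²/c²)`, `Φ(u) = ∫₀ᵘ K(v) v⁻¹ dv`, whose gradient pairs with `W` to twice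
the integrand. -/
theorem radialFlux_plateau_identity {W : E³ → E³} {a b c : ℝ} (ha : 0 < a) (hab : a < b)
    (hc : 0 < c)
    (hdiv : ∀ θ : E³ → ℝ, IsTestFunctionOn ⟨{x : E³ | x ≠ 0}, isOpen_ne⟩ θ →
      ∫ x, inner ℝ (W x) (gradient θ x) = 0)
    {K : ℝ → ℝ} (hK : ContDiff ℝ ∞ K) (hKs : ∀ u, K u ≠ 0 → a ^ 2 < u ∧ u < b ^ 2) :
    ∫ x : E³, (K (‖x‖ ^ 2) - K (‖x‖ ^ 2 / c ^ 2)) * (inner ℝ (W x) x / ‖x‖ ^ 2) = 0 := by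
  have hK0 : ∀ v, v ≤ a ^ 2 → K v = 0 := fun v hv =>
    not_not.1 fun h => lt_irrefl _ (((hKs v h).1).trans_le hv)
  have hK1 : ∀ v, b ^ 2 ≤ v → K v = 0 := fun v hv =>
    not_not.1 fun h => lt_irrefl _ (hv.trans_lt (hKs v h).2)
  have hg : ContDiff ℝ ∞ fun v => K v * v⁻¹ :=
    radialFlux_contDiff_mul_inv hK (by positivity : (0 : ℝ) < a ^ 2) fun v hv => hK0 v hv.le
  obtain ⟨Φ, hΦ_def⟩ : ∃ Φ : ℝ → ℝ, Φ = fun u => ∫ v in (0 : ℝ)..u, K v * v⁻¹ := ⟨_, rfl⟩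
  have hΦs : ContDiff ℝ ∞ Φ := by
    rw [hΦ_def]
    exact contDiff_primitive hg 0
  have hΦd : ∀ u, HasDerivAt Φ (K u * u⁻¹) u := fun u => by
    rw [hΦ_def]
    exact (hg.continuous.integral_hasStrictDerivAt 0 u).hasDerivAt
  have hΦ0 : ∀ u, u ≤ a ^ 2 → Φ u = 0 := fun u hu => by
    simp only [hΦ_def]
    exact radialFlux_primitive_eq_zero (by positivity : (0 : ℝ) < a ^ 2)
      (fun v hv => by rw [hK0 v hv, zero_mul]) hu
  have hΦ1 : ∀ u, b ^ 2 ≤ u → Φ u = Φ (b ^ 2) := fun u hu => by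
    simp only [hΦ_def]
    exact radialFlux_primitive_eq_const hg.continuous (fun v hv => by rw [hK1 v hv, zero_mul]) hu
  -- the profile `Ψ(u) = Φ(u) - Φ(u/c²)` of `θ` and its derivative
  have hΨd : ∀ u, HasDerivAt (fun u => Φ u - Φ (u / c ^ 2))
      (K u * u⁻¹ - K (u / c ^ 2) * (u / c ^ 2)⁻¹ * (1 / c ^ 2)) u := fun u =>
    (hΦd u).sub ((hΦd (u / c ^ 2)).comp u ((hasDerivAt_id' u).div_const (c ^ 2)))
  have hpt : ∀ x : E³,
      inner ℝ (W x) (gradient (fun x : E³ => Φ (‖x‖ ^ 2) - Φ (‖x‖ ^ 2 / c ^ 2)) x) =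
        2 * ((K (‖x‖ ^ 2) - K (‖x‖ ^ 2 / c ^ 2)) * (inner ℝ (W x) x / ‖x‖ ^ 2)) := by
    intro x
    rw [radialFlux_inner_gradient,
      Literature.Analysis.FluidPDE.fderiv_comp_norm_sq_apply (hΨd (‖x‖ ^ 2)) (W x),
      real_inner_comm (W x) x]
    rcases eq_or_ne x 0 with rfl | hx
    · simp
    · have hu : ‖x‖ ^ 2 ≠ 0 := pow_ne_zero 2 (norm_ne_zero_iff.2 hx)
      have hc2 : c ^ 2 ≠ 0 := pow_ne_zero 2 hc.ne'
      field_simp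
  have h := hdiv _ (radialFlux_isTestFunctionOn hΦs ha hab hc hΦ0 hΦ1)
  simp_rw [hpt] at h
  rw [integral_const_mul] at h
  linarith

/-! ### Shell geometry and the flux density -/

/-- The closed shell `{ρ ≤ ‖x‖ ≤ R}` of `ℝ³` is compact. -/
theorem radialFlux_isCompact_shell (ρ R : ℝ) : IsCompact {x : E³ | ρ ≤ ‖x‖ ∧ ‖x‖ ≤ R} :=
  Metric.isCompact_of_isClosed_isBounded
    ((isClosed_Icc (a := ρ) (b := R)).preimage continuous_norm)
    ((Metric.isBounded_closedBall (x := (0 : E³)) (r := R)).subset fun x hx => by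
      simpa using hx.2)

/-- On a measurable set at distance `≥ ρ > 0` from the origin on which `W` is integrable, the flux
density `⟪W(x), x⟫/|x|²` is integrable (it is measurable and bounded by `ρ⁻¹ |W|`). -/
theorem radialFlux_integrableOn_flux {W : E³ → E³} {S : Set E³} {ρ : ℝ} (hρ : 0 < ρ)
    (hSm : MeasurableSet S) (hSρ : ∀ x ∈ S, ρ ≤ ‖x‖) (hW : IntegrableOn W S volume) :
    IntegrableOn (fun x => inner ℝ (W x) x / ‖x‖ ^ 2) S volume := by
  refine Integrable.mono' (hW.integrable.norm.const_mul ρ⁻¹) ?_ ?_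
  · exact ((hW.integrable.aestronglyMeasurable.aemeasurable.inner aemeasurable_id).div
      (continuous_norm.pow 2).measurable.aemeasurable).aestronglyMeasurable
  · filter_upwards [ae_restrict_mem hSm] with x hx
    have hxρ := hSρ x hx
    have hx0 : 0 < ‖x‖ := hρ.trans_le hxρ
    rw [norm_div, norm_pow, norm_norm, Real.norm_eq_abs, div_le_iff₀ (by positivity)]
    calc |inner ℝ (W x) x| ≤ ‖W x‖ * ‖x‖ := abs_real_inner_le_norm _ _
      _ ≤ ‖W x‖ * ‖x‖ * (‖x‖ / ρ) :=
          le_mul_of_one_le_right (by positivity) ((one_le_div hρ).2 hxρ)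
      _ = ρ⁻¹ * ‖W x‖ * ‖x‖ ^ 2 := by ring

/-- **Stub `stub_radialFluxShellInvariance`** (dilation invariance of the radial flux). For
`W : ℝ³ → ℝ³` locally integrable off the origin and weakly divergence-free there,
`∫_{a<|x|<b} ⟪W,x⟫/|x|² = ∫_{ca<|x|<cb} ⟪W,x⟫/|x|²` (`0 < a < b`, `0 < c`). Proof: the plateau
identity `radialFlux_plateau_identity` for plateaus `K_n → 1_{(a²,b²)}`
(`radialFlux_exists_plateau`), restricted to the compact shell
`{min(a,ca) ≤ |x| ≤ max(b,cb)}` carrying all the integrands, and dominated convergence with the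
bound `|⟪W,x⟫|/|x|²`. -/
theorem stub_radialFluxShellInvariance :
    ∀ (W : EuclideanSpace ℝ (Fin 3) → EuclideanSpace ℝ (Fin 3)) (a b c : ℝ), 0 < a → a < b → 0 < c → MeasureTheory.LocallyIntegrableOn W {x : EuclideanSpace ℝ (Fin 3) | x ≠ 0} MeasureTheory.volume → (∀ θ : EuclideanSpace ℝ (Fin 3) → ℝ, Literature.Analysis.FunctionSpaces.IsTestFunctionOn ⟨{x : EuclideanSpace ℝ (Fin 3) | x ≠ 0}, isOpen_ne⟩ θ → ∫ x, inner ℝ (W x) (gradient θ x) = 0) → ∫ x in {x : EuclideanSpace ℝ (Fin 3) | a < ‖x‖ ∧ ‖x‖ < b}, inner ℝ (W x) x / ‖x‖ ^ 2 = ∫ x in {x : EuclideanSpace ℝ (Fin 3) | c * a < ‖x‖ ∧ ‖x‖ < c * b}, inner ℝ (W x) x / ‖x‖ ^ 2 := by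
  intro W a b c ha hab hc hW hdiv
  have hb : 0 < b := ha.trans hab
  obtain ⟨K, hKs, hK01, hKsupp, hKlim⟩ := radialFlux_exists_plateau ha hab
  -- the two open shells, the compact shell carrying everything, the flux density
  set A : Set E³ := {x | a < ‖x‖ ∧ ‖x‖ < b} with hA
  set B : Set E³ := {x | c * a < ‖x‖ ∧ ‖x‖ < c * b} with hB
  set S : Set E³ := {x | min a (c * a) ≤ ‖x‖ ∧ ‖x‖ ≤ max b (c * b)} with hS
  set f : E³ → ℝ := fun x => inner ℝ (W x) x / ‖x‖ ^ 2 with hf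
  have hAS : A ⊆ S := fun x hx => ⟨(min_le_left _ _).trans hx.1.le, hx.2.le.trans (le_max_left _ _)⟩
  have hBS : B ⊆ S := fun x hx =>
    ⟨(min_le_right _ _).trans hx.1.le, hx.2.le.trans (le_max_right _ _)⟩
  have hAm : MeasurableSet A := measurableSet_Ioo.preimage measurable_norm
  have hBm : MeasurableSet B := measurableSet_Ioo.preimage measurable_norm
  have hSm : MeasurableSet S := measurableSet_Icc.preimage measurable_norm
  have hρ : 0 < min a (c * a) := by positivity
  have hS0 : S ⊆ {x : E³ | x ≠ 0} := fun x hx h0 => by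
    have h1 := hx.1
    rw [h0, norm_zero] at h1
    exact absurd h1 (not_le.2 hρ)
  have hWS : IntegrableOn W S volume :=
    hW.integrableOn_compact_subset hS0 (radialFlux_isCompact_shell _ _)
  have hfS : IntegrableOn f S volume :=
    radialFlux_integrableOn_flux hρ hSm (fun x hx => hx.1) hWS
  -- `K_n(|x|²) ≠ 0 ⇒ x ∈ A`, `K_n(|x|²/c²) ≠ 0 ⇒ x ∈ B`
  have hTA : ∀ x : E³, (a ^ 2 < ‖x‖ ^ 2 ∧ ‖x‖ ^ 2 < b ^ 2) ↔ x ∈ A := fun x => by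
    rw [sq_lt_sq₀ ha.le (norm_nonneg _), sq_lt_sq₀ (norm_nonneg _) hb.le]
    exact Iff.rfl
  have hTB : ∀ x : E³, (a ^ 2 < ‖x‖ ^ 2 / c ^ 2 ∧ ‖x‖ ^ 2 / c ^ 2 < b ^ 2) ↔ x ∈ B := fun x =>
    radialFlux_sq_div_lt_iff ha.le hb.le hc (norm_nonneg _)
  -- pointwise limits: `K_n(u) f(x) → 1_T(x) f(x)` whenever `(a² < u < b²) ↔ x ∈ T`
  have hptlim : ∀ (T : Set E³) (x : E³) (u : ℝ), ((a ^ 2 < u ∧ u < b ^ 2) ↔ x ∈ T) →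
      Tendsto (fun n => K n u * f x) atTop (𝓝 (T.indicator f x)) := by
    intro T x u hu
    by_cases hx : x ∈ T
    · rw [indicator_of_mem hx]
      refine tendsto_const_nhds.congr' ?_
      filter_upwards [hKlim u (hu.2 hx).1 (hu.2 hx).2] with n hn
      rw [hn, one_mul]
    · rw [indicator_of_notMem hx]
      have h0 : ∀ n, K n u = 0 := fun n => not_not.1 fun h => hx (hu.1 (hKsupp n u h))
      simp only [h0, zero_mul]
      exact tendsto_const_nhds
  -- the plateau identity on the shell `S`, for every `n`
  have hn : ∀ n, ∫ x in S, (K n (‖x‖ ^ 2) - K n (‖x‖ ^ 2 / c ^ 2)) * f x = 0 := fun n => by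
    have hzero : ∀ x, x ∉ S → (K n (‖x‖ ^ 2) - K n (‖x‖ ^ 2 / c ^ 2)) * f x = 0 := by
      intro x hx
      have h1 : K n (‖x‖ ^ 2) = 0 := not_not.1 fun h => hx (hAS ((hTA x).1 (hKsupp n _ h)))
      have h2 : K n (‖x‖ ^ 2 / c ^ 2) = 0 :=
        not_not.1 fun h => hx (hBS ((hTB x).1 (hKsupp n _ h)))
      rw [h1, h2, sub_self, zero_mul]
    rw [setIntegral_eq_integral_of_forall_compl_eq_zero hzero]
    exact radialFlux_plateau_identity ha hab hc hdiv (hKs n) (hKsupp n)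
  -- dominated convergence on `S`
  have hlim : Tendsto (fun n => ∫ x in S, (K n (‖x‖ ^ 2) - K n (‖x‖ ^ 2 / c ^ 2)) * f x) atTop
      (𝓝 (∫ x in S, (A.indicator f x - B.indicator f x))) := by
    refine tendsto_integral_of_dominated_convergence (fun x => ‖f x‖) (fun n => ?_)
      hfS.integrable.norm (fun n => ae_of_all _ fun x => ?_) (ae_of_all _ fun x => ?_)
    · have hKc := (hKs n).continuous
      exact (((hKc.comp (continuous_norm.pow 2)).sub
        (hKc.comp ((continuous_norm.pow 2).div_const _))).aestronglyMeasurable).mul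
        hfS.integrable.aestronglyMeasurable
    · rw [norm_mul]
      refine mul_le_of_le_one_left (norm_nonneg _) ?_
      rw [Real.norm_eq_abs, abs_sub_le_iff]
      have h1 := hK01 n (‖x‖ ^ 2)
      have h2 := hK01 n (‖x‖ ^ 2 / c ^ 2)
      constructor <;> linarith [h1.1, h1.2, h2.1, h2.2]
    · simp only [sub_mul]
      exact (hptlim A x _ (hTA x)).sub (hptlim B x _ (hTB x))
  -- the limit of the constant sequence `0` is `∫_A f - ∫_B f`
  have h0 : ∫ x in S, (A.indicator f x - B.indicator f x) = 0 := by
    have hc0 : (fun n => ∫ x in S, (K n (‖x‖ ^ 2) - K n (‖x‖ ^ 2 / c ^ 2)) * f x) =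
        fun _ => (0 : ℝ) := funext hn
    rw [hc0] at hlim
    exact (tendsto_nhds_unique tendsto_const_nhds hlim).symm
  rw [integral_sub (hfS.integrable.indicator hAm) (hfS.integrable.indicator hBm),
    integral_indicator hAm, integral_indicator hBm, Measure.restrict_restrict hAm,
    Measure.restrict_restrict hBm, inter_eq_left.2 hAS, inter_eq_left.2 hBS, sub_eq_zero] at h0
  exact h0

end Summit.AnomalousDissipation.AnomalousDissipation.Theorems

end
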